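import Literature.Topology.Algebra.ProfiniteAutCongruence
import Literature.AnabelianGeometry.AbsoluteAnabelian.LocalReciprocityCofinal
import Mathlib.Topology.Algebra.Category.ProfiniteGrp.Basic
import HarnessLib

/-!
# The congruence topology on `Aut(G)`, II: compactness (DdSMS Thm. 5.3) and the profinite
# groups `Aut(G)`, `Out(G)` of a topologically finitely generated profinite group

Dixon–du Sautoy–Mann–Segal, *Analytic pro-`p` groups* (2nd ed., 1999), §5.2 Theorem 5.3: "If `G` is
a finitely generated profinite group then `Aut(G)` is a profinite group" [cite: DixonEtAl1999,
§5.2 Thm 5.3]; use-site: Mochizuki [SemiAnbd] Def. 2.3 (iii) p. 25 / Def. 5.1 (i)(c) p. 62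
("`Out(π̂₁(G_c))` is equipped with a natural profinite group structure").

Continuation of `ProfiniteAutCongruence.lean` (part I: `charCore`, `LevelAut`, `levelMap`, the
congruence topology `CongrAut G`, Hausdorff and totally disconnected).  Here, for `G` a topologically
finitely generated profinite group (`[CompactSpace G] [TotallyDisconnectedSpace G]`,
`hG : IsTopologicallyFinitelyGenerated G`):

* `IsCompatible σ` — compatibility of a family `σ ∈ Π_n Aut(G ⧸ charCore G n)` with the projections
  `G ⧸ charCore G (n+1) → G ⧸ charCore G n`; the compatible families form a CLOSED set and contain
  the range of `levelMap`;
* `lift σ` — **integration**: every compatible family is the family of levels of a (unique)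
  bi-continuous automorphism of `G` (Cantor intersection of the cosets `π_n⁻¹(σ_n(ḡ))`), so
  `range levelMap = {σ | IsCompatible σ}` (`range_levelMap`);
* **Theorem 5.3**: `CongrAut G` is compact (`compactSpace_congrAut`), hence a profinite group —
  bundled `congrAutProfinite hG : ProfiniteGrp` with `congrAutProfinite hG ≃* contMulAut G` by `rfl`;
* `Out(G)`: the inner automorphisms form the CLOSED normal subgroup `innerCongr G` (continuous image
  of the compact `G`), and `CongrOut G := CongrAut G ⧸ innerCongr G` with the quotient topology is a
  profinite group (`congrOutProfinite hG : ProfiniteGrp`), isomorphic as a group to the tree's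
  `TopOut G` (`CongrOut.equivTopOut`).

Mathlib-level; elementary; no side is taken on anything disputed.
-/

namespace Literature.Topology.Algebra

open _root_.Topology Literature.AnabelianGeometry.AbsoluteAnabelian
open Literature.AnabelianGeometry.EtaleTheta (contMulAut mem_contMulAut innerAut innerContAut TopOut
  innerAut_le_contMulAut)

universe u

variable {G : Type u} [Group G] [TopologicalSpace G] [IsTopologicalGroup G]

/-! ## Compatible families -/

variable (G) in
/-- The projection `G ⧸ charCore G (n+1) → G ⧸ charCore G n`. [cite: DixonEtAl1999, §5.2 Thm 5.3] -/
def charCoreCast (n : ℕ) : G ⧸ charCore G (n + 1) →* G ⧸ charCore G n :=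
  QuotientGroup.map (charCore G (n + 1)) (charCore G n) (MonoidHom.id G) (charCore_succ_le n)

/-- `charCoreCast` on classes. [cite: DixonEtAl1999, §5.2 Thm 5.3] -/
@[simp] theorem charCoreCast_mk (n : ℕ) (g : G) :
    charCoreCast G n (g : G ⧸ charCore G (n + 1)) = (g : G ⧸ charCore G n) :=
  QuotientGroup.map_mk _ _ _ _ g

/-- A family `σ = (σ_n) ∈ Π_n Aut(G ⧸ charCore G n)` is COMPATIBLE when consecutive levels commute
with the projections. [cite: DixonEtAl1999, §5.2 Thm 5.3] -/
def IsCompatible (σ : ∀ n : ℕ, LevelAut G n) : Prop :=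
  ∀ (n : ℕ) (q : G ⧸ charCore G (n + 1)),
    charCoreCast G n (LevelAut.equivMulAut (n + 1) (σ (n + 1)) q) =
      LevelAut.equivMulAut n (σ n) (charCoreCast G n q)

/-- The levels of a bi-continuous automorphism form a compatible family.
[cite: DixonEtAl1999, §5.2 Thm 5.3] -/
theorem isCompatible_levelMap (φ : CongrAut G) : IsCompatible (CongrAut.levelMap G φ) := by
  intro n q
  induction q using QuotientGroup.induction_on with
  | H g =>
    change charCoreCast G n (LevelAut.equivMulAut (n + 1) (levelHom G (n + 1) φ) _) =
      LevelAut.equivMulAut n (levelHom G n φ) (charCoreCast G n _)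
    rw [levelHom_mk, charCoreCast_mk, charCoreCast_mk, levelHom_mk]

/-- The compatible families form a closed subset of `Π_n Aut(G ⧸ charCore G n)` (each condition
involves two discrete coordinates). [cite: DixonEtAl1999, §5.2 Thm 5.3] -/
theorem isClosed_setOf_isCompatible : IsClosed {σ : ∀ n : ℕ, LevelAut G n | IsCompatible σ} := by
  have : {σ : ∀ n : ℕ, LevelAut G n | IsCompatible σ} =
      ⋂ n : ℕ, (fun σ : ∀ n : ℕ, LevelAut G n => (σ (n + 1), σ n)) ⁻¹'
        {p : LevelAut G (n + 1) × LevelAut G n | ∀ q : G ⧸ charCore G (n + 1),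
          charCoreCast G n (LevelAut.equivMulAut (n + 1) p.1 q) =
            LevelAut.equivMulAut n p.2 (charCoreCast G n q)} := by
    ext σ
    simp only [Set.mem_setOf_eq, Set.mem_iInter, Set.mem_preimage, IsCompatible]
  rw [this]
  exact isClosed_iInter fun n =>
    (isClosed_discrete _).preimage ((continuous_apply (n + 1)).prodMk (continuous_apply n))

/-! ## Integration of a compatible family (the congruence topology is complete) -/

section Lift

variable [CompactSpace G] (hG : IsTopologicallyFinitelyGenerated G)
  {σ : ∀ n : ℕ, LevelAut G n} (hσ : IsCompatible σ)

/-- The `n`-th fibre over `g`: the coset `π_n⁻¹(σ_n(ḡ))`. [cite: DixonEtAl1999, §5.2 Thm 5.3] -/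
def liftFibre (σ : ∀ n : ℕ, LevelAut G n) (g : G) (n : ℕ) : Set G :=
  {x | (x : G ⧸ charCore G n) = LevelAut.equivMulAut n (σ n) (g : G ⧸ charCore G n)}

include hG in
omit [CompactSpace G] in
/-- The fibres are closed (the quotients are discrete as `charCore G n` is open).
[cite: DixonEtAl1999, §5.2 Thm 5.3] -/
theorem isClosed_liftFibre (g : G) (n : ℕ) : IsClosed (liftFibre σ g n) := by
  haveI : DiscreteTopology (G ⧸ charCore G n) := QuotientGroup.discreteTopology (isOpen_charCore hG n)
  exact (isClosed_discrete {LevelAut.equivMulAut n (σ n) (g : G ⧸ charCore G n)}).preimage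
    QuotientGroup.continuous_mk

omit [CompactSpace G] in
/-- The fibres are nonempty. [cite: DixonEtAl1999, §5.2 Thm 5.3] -/
theorem liftFibre_nonempty (g : G) (n : ℕ) : (liftFibre σ g n).Nonempty := by
  obtain ⟨x, hx⟩ := QuotientGroup.mk_surjective (LevelAut.equivMulAut n (σ n) (g : G ⧸ charCore G n))
  exact ⟨x, hx⟩

include hσ in
omit [CompactSpace G] in
/-- The fibres decrease (compatibility). [cite: DixonEtAl1999, §5.2 Thm 5.3] -/
theorem liftFibre_succ_subset (g : G) (n : ℕ) : liftFibre σ g (n + 1) ⊆ liftFibre σ g n := by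
  intro x hx
  have h := congrArg (charCoreCast G n) hx
  rw [charCoreCast_mk, hσ n, charCoreCast_mk] at h
  exact h

include hG hσ in
/-- Cantor intersection: some `x` lies in every fibre over `g`. [cite: DixonEtAl1999, §5.2 Thm 5.3] -/
theorem exists_mem_liftFibre (g : G) : ∃ x, ∀ n, x ∈ liftFibre σ g n := by
  have h := IsCompact.nonempty_iInter_of_sequence_nonempty_isCompact_isClosed (liftFibre σ g)
    (liftFibre_succ_subset hσ g) (liftFibre_nonempty g) (isClosed_liftFibre hG g 0).isCompact
    (isClosed_liftFibre hG g)
  obtain ⟨x, hx⟩ := h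
  exact ⟨x, fun n => Set.mem_iInter.mp hx n⟩

/-- The integrated map `G → G` of a compatible family (a choice of the unique point of the fibres).
[cite: DixonEtAl1999, §5.2 Thm 5.3] -/
noncomputable def liftFun (g : G) : G := (exists_mem_liftFibre hG hσ g).choose

/-- Defining property of `liftFun`: it is `σ_n` at every level. [cite: DixonEtAl1999, §5.2 Thm 5.3] -/
theorem liftFun_spec (g : G) (n : ℕ) :
    ((liftFun hG hσ g : G) : G ⧸ charCore G n) = LevelAut.equivMulAut n (σ n) (g : G ⧸ charCore G n) :=
  (exists_mem_liftFibre hG hσ g).choose_spec n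

variable [TotallyDisconnectedSpace G]

/-- Uniqueness: an element with the levels `σ_n(ḡ)` is `liftFun g`. [cite: DixonEtAl1999, §5.2 Thm 5.3] -/
theorem eq_liftFun {g x : G}
    (hx : ∀ n, (x : G ⧸ charCore G n) = LevelAut.equivMulAut n (σ n) (g : G ⧸ charCore G n)) :
    x = liftFun hG hσ g :=
  eq_of_forall_quotient_eq fun n => by rw [hx n, liftFun_spec hG hσ g n]

/-- `liftFun` is multiplicative. [cite: DixonEtAl1999, §5.2 Thm 5.3] -/
theorem liftFun_mul (g h : G) : liftFun hG hσ (g * h) = liftFun hG hσ g * liftFun hG hσ h := by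
  symm
  apply eq_liftFun hG hσ
  intro n
  rw [QuotientGroup.mk_mul, QuotientGroup.mk_mul, map_mul, liftFun_spec, liftFun_spec]

omit [CompactSpace G] [TotallyDisconnectedSpace G] in
include hσ in
/-- The inverse family is compatible. [cite: DixonEtAl1999, §5.2 Thm 5.3] -/
theorem isCompatible_inv : IsCompatible σ⁻¹ := by
  intro n q
  have h := hσ n ((LevelAut.equivMulAut (n + 1) (σ (n + 1))).symm q)
  rw [MulEquiv.apply_symm_apply] at h
  change charCoreCast G n ((LevelAut.equivMulAut (n + 1) (σ (n + 1)))⁻¹ q) =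
    (LevelAut.equivMulAut n (σ n))⁻¹ (charCoreCast G n q)
  rw [MulAut.inv_apply, MulAut.inv_apply, h, MulEquiv.symm_apply_apply]

/-- `liftFun σ⁻¹` is a left inverse of `liftFun σ`. [cite: DixonEtAl1999, §5.2 Thm 5.3] -/
theorem liftFun_inv_liftFun (g : G) : liftFun hG (isCompatible_inv hσ) (liftFun hG hσ g) = g := by
  symm
  apply eq_of_forall_quotient_eq
  intro n
  rw [liftFun_spec hG (isCompatible_inv hσ), liftFun_spec hG hσ]
  change _ = (LevelAut.equivMulAut n (σ n))⁻¹ (LevelAut.equivMulAut n (σ n) _)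
  rw [MulAut.inv_apply_self]

/-- `liftFun σ⁻¹` is a right inverse of `liftFun σ`. [cite: DixonEtAl1999, §5.2 Thm 5.3] -/
theorem liftFun_liftFun_inv (g : G) : liftFun hG hσ (liftFun hG (isCompatible_inv hσ) g) = g := by
  symm
  apply eq_of_forall_quotient_eq
  intro n
  rw [liftFun_spec hG hσ, liftFun_spec hG (isCompatible_inv hσ)]
  change _ = LevelAut.equivMulAut n (σ n) ((LevelAut.equivMulAut n (σ n))⁻¹ _)
  rw [MulAut.apply_inv_self]

/-- The integrated automorphism `G ≃* G` of a compatible family. [cite: DixonEtAl1999, §5.2 Thm 5.3] -/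
noncomputable def liftEquiv : G ≃* G where
  toFun := liftFun hG hσ
  invFun := liftFun hG (isCompatible_inv hσ)
  left_inv := liftFun_inv_liftFun hG hσ
  right_inv := liftFun_liftFun_inv hG hσ
  map_mul' := liftFun_mul hG hσ

/-- `liftEquiv` is `liftFun` as a function. [cite: DixonEtAl1999, §5.2 Thm 5.3] -/
@[simp] theorem liftEquiv_apply (g : G) : liftEquiv hG hσ g = liftFun hG hσ g := rfl

omit [TotallyDisconnectedSpace G] in
/-- `liftFun` maps `charCore G n` into itself. [cite: DixonEtAl1999, §5.2 Thm 5.3] -/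
theorem liftFun_mem_charCore {n : ℕ} {v : G} (hv : v ∈ charCore G n) : liftFun hG hσ v ∈ charCore G n := by
  rw [← QuotientGroup.eq_one_iff, liftFun_spec hG hσ, (QuotientGroup.eq_one_iff v).mpr hv, map_one]

/-- The integrated automorphism is continuous (it preserves the neighbourhood basis `charCore G n`).
[cite: DixonEtAl1999, §5.2 Thm 5.3] -/
theorem continuous_liftEquiv : Continuous (liftEquiv hG hσ) := by
  apply continuous_of_continuousAt_one (liftEquiv hG hσ).toMonoidHom
  rw [ContinuousAt, map_one]
  intro W hW
  obtain ⟨W', hW'W, hW'o, h1⟩ := mem_nhds_iff.mp hW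
  obtain ⟨n, -, hn⟩ := exists_charCore_subset (G := G) hW'o h1
  exact Filter.mem_map.mpr (Filter.mem_of_superset
    ((isOpen_charCore hG n).mem_nhds (charCore G n).one_mem)
    fun v hv => hW'W (hn (liftFun_mem_charCore hG hσ hv)))

/-- **The lift** of a compatible family to `Aut_top(G)` (congruence topology).
[cite: DixonEtAl1999, §5.2 Thm 5.3] -/
noncomputable def lift : CongrAut G :=
  (⟨(liftEquiv hG hσ : MulAut G),
    (mem_contMulAut G).mpr ⟨continuous_liftEquiv hG hσ, continuous_liftEquiv hG (isCompatible_inv hσ)⟩⟩ :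
    contMulAut G)

/-- The levels of the lift are the given family. [cite: DixonEtAl1999, §5.2 Thm 5.3] -/
theorem levelMap_lift : CongrAut.levelMap G (lift hG hσ) = σ := by
  funext n
  apply (LevelAut.equivMulAut (G := G) n).injective
  apply MulEquiv.ext
  intro q
  induction q using QuotientGroup.induction_on with
  | H g =>
    change LevelAut.equivMulAut n (levelHom G n _) (g : G ⧸ charCore G n) = _
    rw [levelHom_mk]
    exact liftFun_spec hG hσ g n

end Lift

/-! ## Theorem 5.3: `Aut(G)` is profinite -/

section Profinite

variable [CompactSpace G] [TotallyDisconnectedSpace G] (hG : IsTopologicallyFinitelyGenerated G)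

include hG in
/-- The range of `levelMap` is exactly the set of compatible families.
[cite: DixonEtAl1999, §5.2 Thm 5.3] -/
theorem range_levelMap : Set.range (CongrAut.levelMap G) = {σ | IsCompatible σ} := by
  ext σ
  constructor
  · rintro ⟨φ, rfl⟩
    exact isCompatible_levelMap φ
  · intro hσ
    exact ⟨lift hG hσ, levelMap_lift hG hσ⟩

include hG in
/-- `levelMap` is a closed embedding (congruence topology ↪ product of the finite discrete level
groups). [cite: DixonEtAl1999, §5.2 Thm 5.3] -/
theorem isClosedEmbedding_levelMap : IsClosedEmbedding (CongrAut.levelMap G) :=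
  ⟨CongrAut.isEmbedding_levelMap, by rw [range_levelMap hG]; exact isClosed_setOf_isCompatible⟩

include hG in
/-- **DdSMS Theorem 5.3 (compactness)**: for `G` a topologically finitely generated profinite
group, `Aut(G)` with the congruence topology is compact. [cite: DixonEtAl1999, §5.2 Thm 5.3] -/
theorem compactSpace_congrAut : CompactSpace (CongrAut G) := by
  haveI : ∀ n, Finite (LevelAut G n) := LevelAut.finite hG
  haveI : ∀ n, CompactSpace (LevelAut G n) := fun n => Finite.compactSpace
  exact (isClosedEmbedding_levelMap hG).compactSpace

/-- **DdSMS Theorem 5.3**: `Aut(G)` of a topologically finitely generated profinite group `G`, with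
the congruence topology, as a PROFINITE GROUP. Its underlying group is the tree's `contMulAut G`
(`CongrAut.equivContMulAut`, the identity). [cite: DixonEtAl1999, §5.2 Thm 5.3] -/
noncomputable def congrAutProfinite : ProfiniteGrp.{u} :=
  letI : CompactSpace (CongrAut G) := compactSpace_congrAut hG
  ProfiniteGrp.of (CongrAut G)

/-- The underlying group of `congrAutProfinite hG` is `Aut_top(G) = contMulAut G`.
[cite: DixonEtAl1999, §5.2 Thm 5.3] -/
noncomputable def congrAutProfiniteEquiv : congrAutProfinite hG ≃* contMulAut G := MulEquiv.refl _

end Profinite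

end Literature.Topology.Algebra
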